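import Mathlib
import HarnessLib
import Summits.Ventures.LatticeQCDFlow.Exactness.NCMCGeneralSpaceDissipation

/-!
# The reverse path law is the exponential tilt of the forward one; mean dissipated work is a relative entropy

HONEST FRAMING: exact (Metropolis-corrected) sampling algorithms for lattice gauge theory;
figures of merit are autocorrelation/cost numbers at stated couplings and volumes; no
continuum-physics claim.

Venture `LatticeQCDFlow` (cell pub-lqcd), topic `Exactness`; FANOUT row 13 (`eng-snf`, GEN-10).
NEW WORK of the cell (general measure theory, elementary), not a published result; nothing is
cited as a fact (G. E. Crooks 1998/2000; R. Kawai, J. M. R. Parrondo, C. Van den Broeck,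
Phys. Rev. Lett. 98 (2007) 080602 "dissipation: the phase-space perspective" named only).
General-state-space counterpart of the finite path-space identity
`Scaling/StochasticBudgets.kl_path_eq_dissipation` (theory-2, `D(P_F ‖ P_R) = ⟨W⟩_F − ΔF` for
finite stochastic protocols) — here for ANY Crooks pair (stochastic steps with adjoints,
Jacobian-charged layers, concatenations) and with Mathlib's own divergence.
Setting of `NCMCGeneralSpace.lean` / `NCMCGeneralSpaceDissipation.lean`: a Crooks pair
`(κF, κR, s, e, W)` from `ν₀` to `ν₁` on a general measurable state space, the normalised record
laws `P_F = fwdPathLaw ν₀ κF` and `P_R = fwdPathLaw ν₁ κR` (both on the SAME space of records `E`),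
and the real `ΔF` with `e^{−ΔF} = Z₁/Z₀` (hypothesis `hΔF`).

## Content (Mathlib's `Measure.tilted`, `MeasureTheory.llr`, `InformationTheory.klDiv`)

* **`CrooksPair.revPathLaw_eq_tilted`** — `P_R = P_F.tilted (−W)`: the reverse path law IS the
  exponential tilt of the forward path law by minus the work (Crooks' theorem, normalised);
  `fwdPathLaw_eq_tilted` — `P_F = P_R.tilted W`; `revPathLaw_eq_withDensity` — the density is
  `dP_R/dP_F = e^{ΔF − W} = e^{−W_d}` (`fwdPathLaw_eq_withDensity`: `dP_F/dP_R = e^{W − ΔF}`); the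
  two laws are mutually absolutely continuous
  (`revPathLaw_absolutelyContinuous`, `fwdPathLaw_absolutelyContinuous`).
* `CrooksPair.llr_fwd_rev` / `llr_rev_fwd` — the log-likelihood ratios are `W − ΔF` (`P_F`-a.s.)
  and `ΔF − W` (`P_R`-a.s.): the dissipated work of each lane is the log-likelihood ratio of its
  own path law against the other lane's.
* **`CrooksPair.toReal_klDiv_fwd_rev`** / `toReal_klDiv_rev_fwd` — MEAN DISSIPATED WORK IS A RELATIVE
  ENTROPY: `KL(P_F ‖ P_R) = E_{P_F}[W − ΔF]` and `KL(P_R ‖ P_F) = E_{P_R}[ΔF − W]` (as `toReal` of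
  Mathlib's `klDiv`, no integrability hypothesis — both sides are `0` by convention when `W` is not
  integrable); `klDiv_fwd_rev_of_integrable` / `klDiv_fwd_rev_of_not_integrable` give the `ℝ≥0∞`
  value (`= ofReal (E_{P_F}[W] − ΔF)`, resp. `= ∞`).  Gibbs' inequality is then the second law of
  `NCMCGeneralSpaceDissipation.lean` again.
* **`CrooksPair.fwdPathLaw_eq_revPathLaw_iff`** — `P_F = P_R` iff `W = ΔF` `P_F`-almost surely: the
  forward and reverse trajectory ensembles coincide exactly for the dissipation-free protocols
  (every switch accepted, population ESS one), and only for them.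

Nothing is claimed about any VALUE of a divergence or a mean work for a concrete protocol.
-/

namespace Summit.Ventures.LatticeQCDFlow.Exactness.GeneralNCMC

open MeasureTheory ProbabilityTheory Set Filter InformationTheory
open scoped ENNReal

variable {Ω E : Type*} [MeasurableSpace Ω] [MeasurableSpace E]

namespace CrooksPair

variable {ν₀ ν₁ : Measure Ω} {κF κR : Kernel Ω E} {s e : E → Ω} {W : E → ℝ}

/-! ## The reverse path law as a tilt of the forward one -/

/-- **Crooks' theorem, normalised, as an exponential tilt**: `P_R = P_F.tilted (−W)`, i.e.
`dP_R = e^{−W} dP_F / E_{P_F}[e^{−W}]`. -/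
theorem revPathLaw_eq_tilted [IsFiniteMeasure ν₀] [IsFiniteMeasure ν₁] [IsMarkovKernel κR]
    (h0 : ν₀ univ ≠ 0) (h1 : ν₁ univ ≠ 0) (h : CrooksPair ν₀ ν₁ κF κR s e W) :
    fwdPathLaw ν₁ κR = (fwdPathLaw ν₀ κF).tilted fun ε => -W ε := by
  have hm : Measurable fun ε => ENNReal.ofReal (Real.exp (-W ε)) :=
    (Real.measurable_exp.comp h.measurable_W.neg).ennreal_ofReal
  have hr0 : (ν₀ univ)⁻¹ * ν₁ univ ≠ ⊤ :=
    ENNReal.mul_ne_top (ENNReal.inv_ne_top.2 h0) (measure_ne_top ν₁ univ)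
  have hrpos : 0 < ((ν₀ univ)⁻¹ * ν₁ univ).toReal := toReal_ratio_pos h0 h1
  -- the tilt density is the constant `(Z₁/Z₀)⁻¹` times `e^{−W}`
  have hdens : (fun ε => ENNReal.ofReal (Real.exp (-W ε) / ∫ x, Real.exp (-W x) ∂(fwdPathLaw ν₀ κF))) =
      ((ν₀ univ)⁻¹ * ν₁ univ)⁻¹ • fun ε => ENNReal.ofReal (Real.exp (-W ε)) := by
    funext ε
    rw [h.integral_exp_neg_work, Pi.smul_apply, smul_eq_mul, ENNReal.ofReal_div_of_pos hrpos,
      ENNReal.ofReal_toReal hr0, div_eq_mul_inv, mul_comm]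
  rw [Measure.tilted, hdens, withDensity_smul _ hm, h.fwdPathLaw_withDensity, smul_smul,
    ENNReal.mul_inv (Or.inr (measure_ne_top ν₁ univ)) (Or.inr h1), inv_inv, fwdPathLaw,
    mul_assoc, mul_comm (ν₁ univ)⁻¹, ← mul_assoc, ENNReal.mul_inv_cancel h0 (measure_ne_top ν₀ univ),
    one_mul]

/-- **And conversely** `P_F = P_R.tilted W` (the pair read backwards). -/
theorem fwdPathLaw_eq_tilted [IsFiniteMeasure ν₀] [IsFiniteMeasure ν₁] [IsMarkovKernel κF]
    (h0 : ν₀ univ ≠ 0) (h1 : ν₁ univ ≠ 0) (h : CrooksPair ν₀ ν₁ κF κR s e W) :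
    fwdPathLaw ν₀ κF = (fwdPathLaw ν₁ κR).tilted W := by
  have hs := h.symm.revPathLaw_eq_tilted h1 h0
  simpa only [neg_neg] using hs

/-- **The density of the reverse path law against the forward one is `e^{ΔF − W} = e^{−W_d}`.** -/
theorem revPathLaw_eq_withDensity [IsFiniteMeasure ν₀] [IsFiniteMeasure ν₁] [IsMarkovKernel κR]
    (h0 : ν₀ univ ≠ 0) (h1 : ν₁ univ ≠ 0) (h : CrooksPair ν₀ ν₁ κF κR s e W) {ΔF : ℝ}
    (hΔF : Real.exp (-ΔF) = ((ν₀ univ)⁻¹ * ν₁ univ).toReal) :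
    fwdPathLaw ν₁ κR =
      (fwdPathLaw ν₀ κF).withDensity fun ε => ENNReal.ofReal (Real.exp (ΔF - W ε)) := by
  rw [h.revPathLaw_eq_tilted h0 h1, Measure.tilted, h.integral_exp_neg_work, ← hΔF]
  congr 1
  funext ε
  rw [← Real.exp_sub]
  congr 2
  ring

/-- **… and the density of the forward path law against the reverse one is `e^{W − ΔF} = e^{W_d}`**
(the pair read backwards). -/
theorem fwdPathLaw_eq_withDensity [IsFiniteMeasure ν₀] [IsFiniteMeasure ν₁] [IsMarkovKernel κF]
    (h0 : ν₀ univ ≠ 0) (h1 : ν₁ univ ≠ 0) (h : CrooksPair ν₀ ν₁ κF κR s e W) {ΔF : ℝ}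
    (hΔF : Real.exp (-ΔF) = ((ν₀ univ)⁻¹ * ν₁ univ).toReal) :
    fwdPathLaw ν₀ κF =
      (fwdPathLaw ν₁ κR).withDensity fun ε => ENNReal.ofReal (Real.exp (W ε - ΔF)) := by
  have hs := h.symm.revPathLaw_eq_withDensity h1 h0 (exp_freeEnergyDiff h0 h1 hΔF)
  simpa only [sub_neg_eq_add, neg_add_eq_sub] using hs

/-- `P_R ≪ P_F`. -/
theorem revPathLaw_absolutelyContinuous [IsFiniteMeasure ν₀] [IsFiniteMeasure ν₁]
    [IsMarkovKernel κR] (h0 : ν₀ univ ≠ 0) (h1 : ν₁ univ ≠ 0)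
    (h : CrooksPair ν₀ ν₁ κF κR s e W) : fwdPathLaw ν₁ κR ≪ fwdPathLaw ν₀ κF := by
  rw [h.revPathLaw_eq_tilted h0 h1]
  exact tilted_absolutelyContinuous _ _

/-- `P_F ≪ P_R`. -/
theorem fwdPathLaw_absolutelyContinuous [IsFiniteMeasure ν₀] [IsFiniteMeasure ν₁]
    [IsMarkovKernel κF] (h0 : ν₀ univ ≠ 0) (h1 : ν₁ univ ≠ 0)
    (h : CrooksPair ν₀ ν₁ κF κR s e W) : fwdPathLaw ν₀ κF ≪ fwdPathLaw ν₁ κR := by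
  rw [h.fwdPathLaw_eq_tilted h0 h1]
  exact tilted_absolutelyContinuous _ _

/-! ## Log-likelihood ratios are dissipated works -/

/-- **`log dP_F/dP_R = W − ΔF`**, `P_F`-almost surely. -/
theorem llr_fwd_rev [IsFiniteMeasure ν₀] [IsFiniteMeasure ν₁] [IsMarkovKernel κF]
    [IsMarkovKernel κR] (h0 : ν₀ univ ≠ 0) (h1 : ν₁ univ ≠ 0)
    (h : CrooksPair ν₀ ν₁ κF κR s e W) {ΔF : ℝ}
    (hΔF : Real.exp (-ΔF) = ((ν₀ univ)⁻¹ * ν₁ univ).toReal) :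
    llr (fwdPathLaw ν₀ κF) (fwdPathLaw ν₁ κR) =ᵐ[fwdPathLaw ν₀ κF] fun ε => W ε - ΔF := by
  haveI := isProbabilityMeasure_fwdPathLaw ν₀ h0 κF
  rw [h.revPathLaw_eq_tilted h0 h1]
  have hint : Integrable (fun ε => Real.exp (-W ε)) (fwdPathLaw ν₀ κF) :=
    h.integrable_exp_neg_work h0
  filter_upwards [llr_tilted_right (μ := fwdPathLaw ν₀ κF) (f := fun ε => -W ε)
      (Measure.AbsolutelyContinuous.refl _) hint, llr_self (fwdPathLaw ν₀ κF)] with ε hε h0ε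
  rw [hε, h0ε, h.integral_exp_neg_work, ← hΔF, Real.log_exp, Pi.zero_apply]
  ring

/-- **`log dP_R/dP_F = ΔF − W`**, `P_R`-almost surely (the reverse lane's dissipated work). -/
theorem llr_rev_fwd [IsFiniteMeasure ν₀] [IsFiniteMeasure ν₁] [IsMarkovKernel κF]
    [IsMarkovKernel κR] (h0 : ν₀ univ ≠ 0) (h1 : ν₁ univ ≠ 0)
    (h : CrooksPair ν₀ ν₁ κF κR s e W) {ΔF : ℝ}
    (hΔF : Real.exp (-ΔF) = ((ν₀ univ)⁻¹ * ν₁ univ).toReal) :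
    llr (fwdPathLaw ν₁ κR) (fwdPathLaw ν₀ κF) =ᵐ[fwdPathLaw ν₁ κR] fun ε => ΔF - W ε := by
  have hs := h.symm.llr_fwd_rev h1 h0 (exp_freeEnergyDiff h0 h1 hΔF)
  filter_upwards [hs] with ε hε
  rw [hε]
  ring

/-! ## Mean dissipated work is a relative entropy -/

/-- **`KL(P_F ‖ P_R) = E_{P_F}[W − ΔF]`** — the forward lane's mean dissipated work is the relative
entropy of the forward path law with respect to the reverse one (`toReal` form; when `W` is not
`P_F`-integrable both sides are `0` by Mathlib's conventions). -/
theorem toReal_klDiv_fwd_rev [IsFiniteMeasure ν₀] [IsFiniteMeasure ν₁] [IsMarkovKernel κF]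
    [IsMarkovKernel κR] (h0 : ν₀ univ ≠ 0) (h1 : ν₁ univ ≠ 0)
    (h : CrooksPair ν₀ ν₁ κF κR s e W) {ΔF : ℝ}
    (hΔF : Real.exp (-ΔF) = ((ν₀ univ)⁻¹ * ν₁ univ).toReal) :
    (klDiv (fwdPathLaw ν₀ κF) (fwdPathLaw ν₁ κR)).toReal =
      ∫ ε, (W ε - ΔF) ∂(fwdPathLaw ν₀ κF) := by
  haveI := isProbabilityMeasure_fwdPathLaw ν₀ h0 κF
  haveI := isProbabilityMeasure_fwdPathLaw ν₁ h1 κR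
  rw [toReal_klDiv_of_measure_eq (h.fwdPathLaw_absolutelyContinuous h0 h1)
    (by rw [measure_univ, measure_univ])]
  exact integral_congr_ae (h.llr_fwd_rev h0 h1 hΔF)

/-- **`KL(P_R ‖ P_F) = E_{P_R}[ΔF − W]`** — the reverse lane's mean dissipated work. -/
theorem toReal_klDiv_rev_fwd [IsFiniteMeasure ν₀] [IsFiniteMeasure ν₁] [IsMarkovKernel κF]
    [IsMarkovKernel κR] (h0 : ν₀ univ ≠ 0) (h1 : ν₁ univ ≠ 0)
    (h : CrooksPair ν₀ ν₁ κF κR s e W) {ΔF : ℝ}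
    (hΔF : Real.exp (-ΔF) = ((ν₀ univ)⁻¹ * ν₁ univ).toReal) :
    (klDiv (fwdPathLaw ν₁ κR) (fwdPathLaw ν₀ κF)).toReal =
      ∫ ε, (ΔF - W ε) ∂(fwdPathLaw ν₁ κR) := by
  haveI := isProbabilityMeasure_fwdPathLaw ν₀ h0 κF
  haveI := isProbabilityMeasure_fwdPathLaw ν₁ h1 κR
  rw [toReal_klDiv_of_measure_eq (h.revPathLaw_absolutelyContinuous h0 h1)
    (by rw [measure_univ, measure_univ])]
  exact integral_congr_ae (h.llr_rev_fwd h0 h1 hΔF)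

/-- The `ℝ≥0∞`-valued divergence for an integrable work: `KL(P_F ‖ P_R) = ofReal (E_{P_F}[W] − ΔF)`. -/
theorem klDiv_fwd_rev_of_integrable [IsFiniteMeasure ν₀] [IsFiniteMeasure ν₁] [IsMarkovKernel κF]
    [IsMarkovKernel κR] (h0 : ν₀ univ ≠ 0) (h1 : ν₁ univ ≠ 0)
    (h : CrooksPair ν₀ ν₁ κF κR s e W) {ΔF : ℝ}
    (hΔF : Real.exp (-ΔF) = ((ν₀ univ)⁻¹ * ν₁ univ).toReal)
    (hW : Integrable W (fwdPathLaw ν₀ κF)) :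
    klDiv (fwdPathLaw ν₀ κF) (fwdPathLaw ν₁ κR) =
      ENNReal.ofReal (∫ ε, W ε ∂(fwdPathLaw ν₀ κF) - ΔF) := by
  haveI := isProbabilityMeasure_fwdPathLaw ν₀ h0 κF
  haveI := isProbabilityMeasure_fwdPathLaw ν₁ h1 κR
  have hllr : Integrable (llr (fwdPathLaw ν₀ κF) (fwdPathLaw ν₁ κR)) (fwdPathLaw ν₀ κF) :=
    (integrable_congr (h.llr_fwd_rev h0 h1 hΔF)).2 (hW.sub (integrable_const ΔF))
  rw [klDiv_of_ac_of_integrable (h.fwdPathLaw_absolutelyContinuous h0 h1) hllr,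
    integral_congr_ae (h.llr_fwd_rev h0 h1 hΔF), integral_sub hW (integrable_const ΔF),
    integral_const, smul_eq_mul, probReal_univ, probReal_univ, one_mul]
  congr 1
  ring

/-- … and `KL(P_F ‖ P_R) = ∞` when the work is not `P_F`-integrable. -/
theorem klDiv_fwd_rev_of_not_integrable [IsFiniteMeasure ν₀] [IsFiniteMeasure ν₁]
    [IsMarkovKernel κF] [IsMarkovKernel κR] (h0 : ν₀ univ ≠ 0) (h1 : ν₁ univ ≠ 0)
    (h : CrooksPair ν₀ ν₁ κF κR s e W) {ΔF : ℝ}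
    (hΔF : Real.exp (-ΔF) = ((ν₀ univ)⁻¹ * ν₁ univ).toReal)
    (hW : ¬ Integrable W (fwdPathLaw ν₀ κF)) :
    klDiv (fwdPathLaw ν₀ κF) (fwdPathLaw ν₁ κR) = ∞ := by
  haveI := isProbabilityMeasure_fwdPathLaw ν₀ h0 κF
  refine klDiv_of_not_integrable fun hllr => hW ?_
  have hsub : Integrable (fun ε => W ε - ΔF) (fwdPathLaw ν₀ κF) :=
    (integrable_congr (h.llr_fwd_rev h0 h1 hΔF)).1 hllr
  have hadd : Integrable (fun ε => W ε + -ΔF) (fwdPathLaw ν₀ κF) := by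
    simpa only [sub_eq_add_neg] using hsub
  exact integrable_add_const_iff.1 hadd

/-! ## The dissipation-free protocols -/

/-- **`P_F = P_R` iff `W = ΔF` almost surely**: the forward and reverse trajectory ensembles coincide
exactly when (and only when) every forward evolution performs the reversible work `ΔF` — the
dissipation-free protocols, for which every Metropolized switch is accepted and the population ESS
is one. -/
theorem fwdPathLaw_eq_revPathLaw_iff [IsFiniteMeasure ν₀] [IsFiniteMeasure ν₁] [IsMarkovKernel κF]
    [IsMarkovKernel κR] (h0 : ν₀ univ ≠ 0) (h1 : ν₁ univ ≠ 0)
    (h : CrooksPair ν₀ ν₁ κF κR s e W) {ΔF : ℝ}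
    (hΔF : Real.exp (-ΔF) = ((ν₀ univ)⁻¹ * ν₁ univ).toReal) :
    fwdPathLaw ν₀ κF = fwdPathLaw ν₁ κR ↔ ∀ᵐ ε ∂(fwdPathLaw ν₀ κF), W ε = ΔF := by
  haveI := isProbabilityMeasure_fwdPathLaw ν₀ h0 κF
  have hd : Measurable fun ε => ENNReal.ofReal (Real.exp (ΔF - W ε)) :=
    (Real.measurable_exp.comp (measurable_const.sub h.measurable_W)).ennreal_ofReal
  rw [h.revPathLaw_eq_withDensity h0 h1 hΔF, eq_comm]
  have key : (fwdPathLaw ν₀ κF).withDensity (fun ε => ENNReal.ofReal (Real.exp (ΔF - W ε))) =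
      fwdPathLaw ν₀ κF ↔
        (fun ε => ENNReal.ofReal (Real.exp (ΔF - W ε))) =ᵐ[fwdPathLaw ν₀ κF] (1 : E → ℝ≥0∞) := by
    conv_lhs => rhs; rw [← withDensity_one (μ := fwdPathLaw ν₀ κF)]
    exact withDensity_eq_iff_of_sigmaFinite hd.aemeasurable aemeasurable_const
  rw [key]
  refine ⟨fun hae => ?_, fun hae => ?_⟩
  · filter_upwards [hae] with ε hε
    have hε' : Real.exp (ΔF - W ε) = 1 := by
      simpa only [Pi.one_apply, ENNReal.ofReal_eq_one] using hε
    rw [Real.exp_eq_one_iff, sub_eq_zero] at hε'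
    exact hε'.symm
  · filter_upwards [hae] with ε hε
    rw [hε, sub_self, Real.exp_zero, ENNReal.ofReal_one, Pi.one_apply]

/-- The same characterisation against the UN-normalised forward record law `ν₀ ∘ κF` (the law the
Crooks identity is stated for). -/
theorem fwdPathLaw_eq_revPathLaw_iff' [IsFiniteMeasure ν₀] [IsFiniteMeasure ν₁] [IsMarkovKernel κF]
    [IsMarkovKernel κR] (h0 : ν₀ univ ≠ 0) (h1 : ν₁ univ ≠ 0)
    (h : CrooksPair ν₀ ν₁ κF κR s e W) {ΔF : ℝ}
    (hΔF : Real.exp (-ΔF) = ((ν₀ univ)⁻¹ * ν₁ univ).toReal) :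
    fwdPathLaw ν₀ κF = fwdPathLaw ν₁ κR ↔ ∀ᵐ ε ∂(ν₀.bind κF), W ε = ΔF := by
  rw [h.fwdPathLaw_eq_revPathLaw_iff h0 h1 hΔF, fwdPathLaw, ae_iff, ae_iff, Measure.smul_apply,
    smul_eq_mul, mul_eq_zero, or_iff_right (ENNReal.inv_ne_zero.2 (measure_ne_top ν₀ univ))]

end CrooksPair

end Summit.Ventures.LatticeQCDFlow.Exactness.GeneralNCMC
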